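import Literature.NumberTheory.Transcendental.GaGmSubgroupMultBound
import Literature.NumberTheory.Transcendental.GaGmTorsionCount
import Literature.NumberTheory.Transcendental.PhilipponZeroEstimateMultidegree
import Mathlib.LinearAlgebra.FreeModule.Finite.CardQuotient
import Mathlib.LinearAlgebra.FreeModule.PID
import Mathlib.RingTheory.Localization.Module
import HarnessLib

/-!
# Slice counts of a connected subgroup of `𝔾ₐ × 𝔾ₘⁿ` as maximal minors of its character lattice

Topic `Literature/NumberTheory/Transcendental`. For an irreducible closed subgroup `H = V × T_A` of
`G = 𝔾ₐ × 𝔾ₘⁿ` with character lattice `A = charGroup H ≤ ℤⁿ` (saturated, of rank `r`,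
`dim T_A = n - r`) and a `ℤ`-basis `M` of `A` (an `r × n` integer matrix), the slice counts of
`GaGmSubgroupMultBound.lean` are the maximal minors of `M`:
`#(H ∩ {x = 0, y_j = 1 (j ∈ J)}) = #(T_A ∩ T_{ℤ^J}) = [ℤⁿ : A + ℤ^J] = |det M_{Jᶜ}|` (`#J = n - r`),
i.e. `GaGm.absMinor M Jᶜ` of Nesterenko 2003, (5.7) (`PhilipponZeroEstimateMultidegree.lean`).
Consequently (`GaGm.exists_basis_factorial_mul_sum_absMinor_le_mult`) the general-rank lower bound
`GaGm.factorial_mul_sum_slice_le_mult` reads, for `D₀, D₁ ≥ 1`,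
`(dim H)! · D₀^{dim V} · D₁^{n-r} · ∑_{#I = r} |det M_I| ≤ mult_{D₀,D₁}(H)` — Philippon's
`𝓗(V × T_A; D₀, D₁, …, D₁)` (Philippon 1986, §3 (*) and Lemme 3.4) in the currency of Nesterenko's
obstruction polynomial `GaGm.nesterenkoH` at equal torus degrees. Everything here is PROVED.

Ingredients: the torsion count `#T_B = [ℤⁿ : B]` (`GaGmTorsionCount.lean`); the index of the row
lattice of a square integer matrix is `|det|` (Mathlib `Submodule.natAbs_det_basis_change`), also
when `det = 0`; the block determinant of `[M; E_J]` after sorting the columns `Jᶜ ⊔ J`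
(`Matrix.det_fromBlocks_zero₂₁`); and `rank A + dim T_A = n` (the tree's `GaGm.exists_latticeData`,
`GaGm.finrank_tangentOf`, with the two ranks compared inside `ℚⁿ`).

## References

* Yu. V. Nesterenko, *Linear forms in logarithms of rational numbers*, LNM 1819 (2003), §5.1,
  formula (5.7) and Prop. 5.1. [Nesterenko2003]
* P. Philippon, *Lemmes de zéros dans les groupes algébriques commutatifs*, Bull. Soc. Math.
  France 114 (1986), 355–383, §3 ((*) p. 362, Lemme 3.4). [Philippon1986]
* A. Borel, *Linear Algebraic Groups*, GTM 126 (1991), §8.5. [Borel1991]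
-/

noncomputable section

open Module Finset

namespace Literature.NumberTheory.Transcendental

namespace GaGm

variable {n : ℕ}

/-! ### The index of the row lattice of a square integer matrix -/

/-- **`[ℤ^ι : row lattice of N] = |det N|`** for a square integer matrix `N` (both sides `0` when
`det N = 0`). [cite: Borel1991, §8.5] -/
theorem index_span_rows_eq_natAbs_det {ι : Type*} [Fintype ι] [DecidableEq ι] (N : Matrix ι ι ℤ) :
    (Submodule.span ℤ (Set.range fun i => N i)).toAddSubgroup.index = N.det.natAbs := by
  classical
  set S : Submodule ℤ (ι → ℤ) := Submodule.span ℤ (Set.range fun i => N i) with hS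
  by_cases hN : N.det = 0
  · rw [hN, Int.natAbs_zero]
    by_contra hidx
    -- `index • e_l ∈ S` for all `l`, giving `C * N = index • 1`
    have hmem : ∀ l : ι, ∃ c : ι → ℤ, ∑ i, c i • N i = (S.toAddSubgroup.index : ℤ) • (Pi.single l (1 : ℤ) : ι → ℤ) := by
      intro l
      have h := AddSubgroup.nsmul_index_mem S.toAddSubgroup (Pi.single l (1 : ℤ))
      rw [Submodule.mem_toAddSubgroup, ← natCast_zsmul] at h
      exact (Submodule.mem_span_range_iff_exists_fun ℤ).mp h
    choose c hc using hmem
    have hCN : (Matrix.of c) * N = (S.toAddSubgroup.index : ℤ) • (1 : Matrix ι ι ℤ) := by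
      ext l l'
      have h := congrFun (hc l) l'
      simp only [Finset.sum_apply, Pi.smul_apply, smul_eq_mul] at h
      rw [Matrix.mul_apply, Matrix.smul_apply, Matrix.one_apply, smul_eq_mul]
      simp only [Matrix.of_apply]
      rw [h, Pi.single_apply]
      by_cases hl : l = l'
      · subst hl; simp
      · rw [if_neg (Ne.symm hl), if_neg hl, mul_zero]
    have hdet := congrArg Matrix.det hCN
    rw [Matrix.det_mul, hN, mul_zero, Matrix.det_smul, Matrix.det_one, mul_one] at hdet
    exact pow_ne_zero _ (Int.natCast_ne_zero.mpr hidx) hdet.symm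
  · have hli := Matrix.linearIndependent_rows_of_det_ne_zero hN
    have h := Submodule.natAbs_det_basis_change (Pi.basisFun ℤ ι) S (Basis.span hli)
    change Nat.card ((ι → ℤ) ⧸ S) = _
    rw [← h]
    have hfun : (Subtype.val ∘ ⇑(Basis.span hli) : ι → ι → ℤ) = fun i => N i := by
      funext i; exact congrArg Subtype.val (Basis.span_apply hli i)
    rw [hfun, Pi.basisFun_det_apply]
    rfl

/-! ### Slices of `H` are torsion subgroups of the torus -/

/-- **Slice count = lattice index.** For a closed subgroup `H` with character lattice
`A = charGroup H` and `J ⊆ {1, …, n}`: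
`#(H ∩ {x = 0, y_j = 1 (j ∈ J)}) = #(T_A ∩ T_{ℤ^J}) = [ℤⁿ : A + ℤ^J]`. [cite: Borel1991, §8.5 Prop. 8.12] -/
theorem ncard_inter_slice_eq_index (H : Subgroup (GaGm n)) (hH : IsClosedG (H : Set (GaGm n)))
    (J : Finset (Fin n)) :
    ((H : Set (GaGm n)) ∩ {g : GaGm n | g.1 = 1 ∧ ∀ j ∈ J, g.2 j = 1}).ncard =
      (charGroup (H : Set (GaGm n)) ⊔
        AddSubgroup.closure (Set.range fun j : ↥J => (Pi.single (j : Fin n) (1 : ℤ) : Fin n → ℤ))).index := by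
  classical
  set B := charGroup (H : Set (GaGm n)) ⊔
    AddSubgroup.closure (Set.range fun j : ↥J => (Pi.single (j : Fin n) (1 : ℤ) : Fin n → ℤ)) with hB
  rw [← natCard_torsion_eq_index B, ← Nat.card_coe_set_eq]
  -- the kernel of the pairing with a torus point is a subgroup containing `B`
  have hker : ∀ y : Fin n → ℂˣ, (∀ χ ∈ charGroup (H : Set (GaGm n)), ∏ j, y j ^ χ j = 1) →
      (∀ j ∈ J, y j = 1) → ∀ χ ∈ B, ∏ j, y j ^ χ j = 1 := by
    intro y hA hJ
    obtain ⟨f, hf⟩ := exists_addMonoidHom_pairing y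
    have hle : B ≤ f.ker := by
      refine sup_le (fun χ hχ => ?_) ((AddSubgroup.closure_le _).mpr ?_)
      · rw [AddMonoidHom.mem_ker, hf, hA χ hχ, ofMul_one]
      · rintro _ ⟨j, rfl⟩
        rw [SetLike.mem_coe, AddMonoidHom.mem_ker, hf, prod_zpow_single, hJ j j.2, ofMul_one]
    intro χ hχ
    have := hle hχ
    rwa [AddMonoidHom.mem_ker, hf, ofMul_eq_zero] at this
  refine Nat.card_congr
    { toFun := fun g => ⟨g.1.2, hker _ (fun χ hχ => (mem_charGroup_iff.mp hχ) g.1 g.2.1) g.2.2.2⟩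
      invFun := fun y => ⟨((1 : Multiplicative ℂ), y.1), ?_, rfl, fun j hj => ?_⟩
      left_inv := fun g => by
        apply Subtype.ext
        exact Prod.ext g.2.2.1.symm rfl
      right_inv := fun y => rfl }
  · exact mem_of_charGroup H hH fun χ hχ => y.2 χ (le_sup_left (b := AddSubgroup.closure _) hχ)
  · have := y.2 _ (le_sup_right (a := charGroup (H : Set (GaGm n)))
      (AddSubgroup.subset_closure ⟨⟨j, hj⟩, rfl⟩))
    rwa [prod_zpow_single] at this

/-! ### The index `[ℤⁿ : A + ℤ^J]` as a maximal minor -/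

/-- **`[ℤⁿ : ⟨rows of M⟩ + ℤ^J] = |det M_{Jᶜ}|`** for an `r × n` integer matrix `M` and `#J = n - r`:
the `n × n` matrix `[M; E_J]` becomes block upper triangular `[[M_{Jᶜ}, M_J], [0, 1]]` after sorting
the columns as `Jᶜ ⊔ J`. [cite: Nesterenko2003, §5.1 (5.7)] -/
theorem index_closure_sup_eq_absMinor {r : ℕ} (M : Matrix (Fin r) (Fin n) ℤ) (J : Finset (Fin n))
    (hJ : r + J.card = n) :
    (AddSubgroup.closure (Set.range fun i => M i) ⊔
        AddSubgroup.closure (Set.range fun j : ↥J => (Pi.single (j : Fin n) (1 : ℤ) : Fin n → ℤ))).index =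
      absMinor M (Finset.univ \ J) := by
  classical
  set I : Finset (Fin n) := Finset.univ \ J with hI
  have hIcard : I.card = r := by
    rw [hI, Finset.card_univ_sdiff, Fintype.card_fin]; omega
  -- the column ordering `Fin r ⊕ J ≃ Fin n`
  let c : Fin r ⊕ ↥J → Fin n := Sum.elim (fun k => (I.orderEmbOfFin hIcard k : Fin n)) (fun j => (j : Fin n))
  have hcI : ∀ k : Fin r, (I.orderEmbOfFin hIcard k : Fin n) ∉ J := fun k => by
    have : (I.orderEmbOfFin hIcard k : Fin n) ∈ I := Finset.orderEmbOfFin_mem I hIcard k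
    exact (Finset.mem_sdiff.mp (le_of_eq hI this)).2
  have hcinj : Function.Injective c := by
    rintro (k | j) (k' | j') h
    · exact congrArg Sum.inl ((I.orderEmbOfFin hIcard).injective h)
    · exfalso
      have h' : (I.orderEmbOfFin hIcard k : Fin n) = (j' : Fin n) := h
      exact hcI k (h' ▸ j'.2)
    · exfalso
      have h' : (j : Fin n) = (I.orderEmbOfFin hIcard k' : Fin n) := h
      exact hcI k' (h' ▸ j.2)
    · exact congrArg Sum.inr (Subtype.ext h)
  have hcbij : Function.Bijective c := by
    rw [Fintype.bijective_iff_injective_and_card]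
    refine ⟨hcinj, ?_⟩
    rw [Fintype.card_sum, Fintype.card_fin, Fintype.card_coe, Fintype.card_fin, hJ]
  let e : Fin r ⊕ ↥J ≃ Fin n := Equiv.ofBijective c hcbij
  -- the square matrix with rows `M i`, `e_j`
  let rows : Fin r ⊕ ↥J → (Fin n → ℤ) := Sum.elim (fun i => M i) (fun j => Pi.single (j : Fin n) (1 : ℤ))
  let N : Matrix (Fin n) (Fin n) ℤ := fun l => rows (e.symm l)
  -- its row lattice
  have hrange : Set.range (fun l => N l) = Set.range (fun i => M i) ∪
      Set.range (fun j : ↥J => (Pi.single (j : Fin n) (1 : ℤ) : Fin n → ℤ)) := by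
    change Set.range (rows ∘ e.symm) = _
    rw [e.symm.surjective.range_comp, Set.Sum.elim_range]
  have hspan : (Submodule.span ℤ (Set.range fun l => N l)).toAddSubgroup =
      AddSubgroup.closure (Set.range fun i => M i) ⊔
        AddSubgroup.closure (Set.range fun j : ↥J => (Pi.single (j : Fin n) (1 : ℤ) : Fin n → ℤ)) := by
    rw [hrange, Submodule.span_union, Submodule.sup_toAddSubgroup, Submodule.span_int_eq_addSubgroupClosure,
      Submodule.span_int_eq_addSubgroupClosure]
  rw [← hspan, index_span_rows_eq_natAbs_det]
  -- the block structure
  let P : Matrix (Fin r ⊕ ↥J) (Fin r ⊕ ↥J) ℤ := fun a b => rows a (e b)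
  have hNP : N = P.submatrix e.symm e.symm := by
    ext l l'
    change rows (e.symm l) l' = rows (e.symm l) (e (e.symm l'))
    rw [Equiv.apply_symm_apply]
  have hP : P = Matrix.fromBlocks (M.submatrix id fun k => (I.orderEmbOfFin hIcard k : Fin n))
      (M.submatrix id fun j : ↥J => (j : Fin n)) 0 1 := by
    ext a b
    rcases a with i | j <;> rcases b with k | j'
    · rfl
    · rfl
    · change (Pi.single (j : Fin n) (1 : ℤ) : Fin n → ℤ) (I.orderEmbOfFin hIcard k) = 0
      rw [Pi.single_eq_of_ne]
      exact fun h => hcI k (h ▸ j.2)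
    · change (Pi.single (j : Fin n) (1 : ℤ) : Fin n → ℤ) (j' : Fin n) = (1 : Matrix ↥J ↥J ℤ) j j'
      rw [Matrix.one_apply, Pi.single_apply]
      simp only [Subtype.coe_inj, eq_comm]
  rw [hNP, Matrix.det_submatrix_equiv_self, hP, Matrix.det_fromBlocks_zero₂₁, Matrix.det_one, mul_one,
    absMinor, dif_pos hIcard]

/-! ### A `ℤ`-basis of the character lattice and `rank A + dim T_A = n` -/

/-- Integer vectors which are `ℤ`-linearly independent are `ℚ`-linearly independent.
[cite: Borel1991, §8.5] -/
theorem linearIndependent_castQ {r : ℕ} {b : Fin r → (Fin n → ℤ)} (hb : LinearIndependent ℤ b) :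
    LinearIndependent ℚ (fun i => castQ (b i)) := by
  have h1 : LinearIndependent ℤ (fun i => castQ (b i)) := by
    have := hb.map' (castQHom (n := n)).toIntLinearMap (by
      rw [LinearMap.ker_eq_bot]
      exact castQ_injective)
    exact this
  exact (LinearIndependent.iff_fractionRing ℤ ℚ).mp h1

/-- **A `ℤ`-basis of the character lattice.** For an irreducible closed subgroup `H = V × T_A`
there is an integer `r × n` matrix whose rows form a `ℤ`-basis of `A = charGroup H`, and
`r + dim T_A = n`. [cite: Borel1991, §8.5] -/
theorem exists_basis_charGroup (H : Subgroup (GaGm n)) (hirr : IsIrred (H : Set (GaGm n))) :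
    ∃ (r : ℕ) (M : Matrix (Fin r) (Fin n) ℤ), LinearIndependent ℤ (fun i => M i) ∧
      charGroup (H : Set (GaGm n)) = AddSubgroup.closure (Set.range fun i => M i) ∧
      r + (toConnAlgSubgroup H hirr).torusDim = n := by
  classical
  set A := charGroup (H : Set (GaGm n)) with hA
  set N : Submodule ℤ (Fin n → ℤ) := AddSubgroup.toIntSubmodule A with hN
  obtain ⟨r, ⟨b⟩⟩ := Submodule.nonempty_basis_of_pid (Pi.basisFun ℤ (Fin n)) N
  set M : Matrix (Fin r) (Fin n) ℤ := fun i => (b i : Fin n → ℤ) with hM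
  have hli : LinearIndependent ℤ (fun i => M i) := b.linearIndependent.map' N.subtype N.ker_subtype
  have hcl : A = AddSubgroup.closure (Set.range fun i => M i) := by
    have h1 : Submodule.span ℤ (Set.range fun i => M i) = N := by
      have := congrArg (Submodule.map N.subtype) b.span_eq
      rw [Submodule.map_span, Submodule.map_top, Submodule.range_subtype, ← Set.range_comp] at this
      exact this
    rw [← Submodule.span_int_eq_addSubgroupClosure, h1, hN, AddSubgroup.toIntSubmodule_toAddSubgroup]
  refine ⟨r, M, hli, hcl, ?_⟩
  -- `r + dim T_A = n` by comparing with the lattice data of `A`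
  obtain ⟨r₀, b₀, Jc, hb₀A, hcard, hli₀, hspan₀, -⟩ := exists_latticeData A
  have htd : (toConnAlgSubgroup H hirr).torusDim = Jc.card := by
    rw [ConnAlgSubgroup.torusDim, torusTangent_eq_tangentOf, toConnAlgSubgroup_chars]
    exact finrank_tangentOf hb₀A hcard hli₀ hspan₀
  -- both families are `ℚ`-bases of `span_ℚ A`
  have hliQ : LinearIndependent ℚ (fun i => castQ (M i)) := linearIndependent_castQ hli
  have hli₀Q : LinearIndependent ℚ (fun i => castQ (b₀ i)) := by
    have h1 : LinearIndependent ℂ (fun i => castC (b₀ i)) := hli₀.comp Sum.inl Sum.inl_injective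
    have h2 : LinearIndependent ℚ (fun i => castC (b₀ i)) := h1.restrict_scalars' ℚ
    have h3 : (fun i => castC (b₀ i)) = castQC ∘ (fun i => castQ (b₀ i)) := by
      funext i; exact (castQC_castQ (b₀ i)).symm
    rw [h3] at h2
    exact LinearIndependent.of_comp _ h2
  set W := Submodule.span ℚ (Set.range fun i => castQ (M i)) with hW
  set W₀ := Submodule.span ℚ (Set.range fun i => castQ (b₀ i)) with hW₀
  have hWW₀ : W = W₀ := by
    apply le_antisymm
    · rw [hW, Submodule.span_le]
      rintro _ ⟨i, rfl⟩
      exact hspan₀ _ (by rw [hcl]; exact AddSubgroup.subset_closure ⟨i, rfl⟩)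
    · rw [hW₀, Submodule.span_le]
      rintro _ ⟨i, rfl⟩
      -- `b₀ i ∈ A = closure (range M)`, and `castQ` maps it into `W`
      have hmem : b₀ i ∈ AddSubgroup.closure (Set.range fun i => M i) := hcl ▸ hb₀A i
      refine AddSubgroup.closure_induction (p := fun x _ => castQ x ∈ (W : Set (Fin n → ℚ))) ?_ ?_ ?_ ?_ hmem
      · rintro _ ⟨k, rfl⟩; exact Submodule.subset_span ⟨k, rfl⟩
      · change castQ 0 ∈ W
        have : castQ (0 : Fin n → ℤ) = 0 := by funext j; simp [castQ]
        rw [this]; exact W.zero_mem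
      · intro x y _ _ hx hy
        change castQ (x + y) ∈ W
        have : castQ (x + y) = castQ x + castQ y := by funext j; simp [castQ]
        rw [this]; exact W.add_mem hx hy
      · intro x _ hx
        change castQ (-x) ∈ W
        have : castQ (-x) = -castQ x := by funext j; simp [castQ]
        rw [this]; exact W.neg_mem hx
  have hr : Module.finrank ℚ W = r := by rw [hW, finrank_span_eq_card hliQ, Fintype.card_fin]
  have hr₀ : Module.finrank ℚ W₀ = r₀ := by rw [hW₀, finrank_span_eq_card hli₀Q, Fintype.card_fin]
  rw [htd]
  have : r = r₀ := by rw [← hr, ← hr₀, hWW₀]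
  omega

/-! ### The multiplicity bound in the currency of maximal minors -/

/-- **General-rank multiplicity bound, minors form.** For an irreducible closed subgroup
`H = V × T_A ≤ ℂ × (ℂˣ)ⁿ` and `D₀, D₁ ≥ 1` there is a `ℤ`-basis `M` (`r × n`) of `A = charGroup H`
with `r + dim T_A = n` and
`(dim H)! · D₀^{dim V} · D₁^{dim T_A} · ∑_{#I = r} |det M_I| ≤ mult_{D₀,D₁}(H)`:
Philippon's `𝓗(V × T_A; D₀, D₁, …, D₁) = (dim)!·D₀^{d₀}·∑_I |det M_I|·D₁^{n-r}` (§3 (*), Lemme 3.4;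
Nesterenko 2003 (5.7) at equal degrees) as a lower bound for the box multiplicity.
[cite: Philippon1986, §3 (*) p. 362 and Lemme 3.4; Nesterenko2003, §5.1 (5.7)] -/
theorem exists_basis_factorial_mul_sum_absMinor_le_mult {D₀ D₁ : ℕ} (hD₀ : 1 ≤ D₀) (hD₁ : 1 ≤ D₁)
    (H : Subgroup (GaGm n)) (hirr : IsIrred (H : Set (GaGm n))) :
    ∃ (r : ℕ) (M : Matrix (Fin r) (Fin n) ℤ), LinearIndependent ℤ (fun i => M i) ∧
      charGroup (H : Set (GaGm n)) = AddSubgroup.closure (Set.range fun i => M i) ∧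
      r + (toConnAlgSubgroup H hirr).torusDim = n ∧
      (dimG (H : Set (GaGm n))).factorial *
        (D₀ ^ (toConnAlgSubgroup H hirr).addDim * (D₁ ^ (toConnAlgSubgroup H hirr).torusDim *
          ∑ I ∈ (Finset.univ : Finset (Fin n)).powersetCard r, absMinor M I)) ≤
        mult D₀ D₁ (H : Set (GaGm n)) := by
  classical
  obtain ⟨r, M, hli, hcl, hrk⟩ := exists_basis_charGroup H hirr
  refine ⟨r, M, hli, hcl, hrk, ?_⟩
  have hmain := factorial_mul_sum_slice_le_mult hD₀ hD₁ H hirr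
  set k := (toConnAlgSubgroup H hirr).torusDim with hk
  -- each slice count is the complementary minor
  have hslice : ∀ J ∈ (Finset.univ : Finset (Fin n)).powersetCard k,
      ((H : Set (GaGm n)) ∩ {g : GaGm n | g.1 = 1 ∧ ∀ j ∈ J, g.2 j = 1}).ncard = absMinor M (Finset.univ \ J) := by
    intro J hJ
    rw [Finset.mem_powersetCard] at hJ
    rw [ncard_inter_slice_eq_index H hirr.isClosedG J, hcl]
    exact index_closure_sup_eq_absMinor M J (by rw [hJ.2]; omega)
  -- reindex the sum by complements
  have hsum : ∑ J ∈ (Finset.univ : Finset (Fin n)).powersetCard k,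
      ((H : Set (GaGm n)) ∩ {g : GaGm n | g.1 = 1 ∧ ∀ j ∈ J, g.2 j = 1}).ncard =
      ∑ I ∈ (Finset.univ : Finset (Fin n)).powersetCard r, absMinor M I := by
    rw [Finset.sum_congr rfl hslice]
    refine Finset.sum_nbij' (fun J => Finset.univ \ J) (fun I => Finset.univ \ I) ?_ ?_ ?_ ?_ ?_
    · intro J hJ
      rw [Finset.mem_powersetCard] at hJ ⊢
      refine ⟨Finset.subset_univ _, ?_⟩
      rw [Finset.card_univ_sdiff, Fintype.card_fin, hJ.2]; omega
    · intro I hI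
      rw [Finset.mem_powersetCard] at hI ⊢
      refine ⟨Finset.subset_univ _, ?_⟩
      rw [Finset.card_univ_sdiff, Fintype.card_fin, hI.2]; omega
    · intro J _; simp
    · intro I _; simp
    · intro J _; rfl
  rw [hsum] at hmain
  exact hmain

/-! ### The same for an arbitrary `ℤ`-basis of the character lattice -/

/-- **Rank of the character lattice.** Every `ℤ`-basis of `A = charGroup H` (`H = V × T_A`
irreducible closed) has `n - dim T_A` elements. [cite: Borel1991, §8.5] -/
theorem basis_card_add_torusDim_eq (H : Subgroup (GaGm n)) (hirr : IsIrred (H : Set (GaGm n))) {r : ℕ}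
    {M : Matrix (Fin r) (Fin n) ℤ} (hli : LinearIndependent ℤ (fun i => M i))
    (hcl : charGroup (H : Set (GaGm n)) = AddSubgroup.closure (Set.range fun i => M i)) :
    r + (toConnAlgSubgroup H hirr).torusDim = n := by
  classical
  set A := charGroup (H : Set (GaGm n)) with hA
  obtain ⟨r₀, b₀, Jc, hb₀A, hcard, hli₀, hspan₀, -⟩ := exists_latticeData A
  have htd : (toConnAlgSubgroup H hirr).torusDim = Jc.card := by
    rw [ConnAlgSubgroup.torusDim, torusTangent_eq_tangentOf, toConnAlgSubgroup_chars]
    exact finrank_tangentOf hb₀A hcard hli₀ hspan₀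
  have hliQ : LinearIndependent ℚ (fun i => castQ (M i)) := linearIndependent_castQ hli
  have hli₀Q : LinearIndependent ℚ (fun i => castQ (b₀ i)) := by
    have h1 : LinearIndependent ℂ (fun i => castC (b₀ i)) := hli₀.comp Sum.inl Sum.inl_injective
    have h2 : LinearIndependent ℚ (fun i => castC (b₀ i)) := h1.restrict_scalars' ℚ
    have h3 : (fun i => castC (b₀ i)) = castQC ∘ (fun i => castQ (b₀ i)) := by
      funext i; exact (castQC_castQ (b₀ i)).symm
    rw [h3] at h2
    exact LinearIndependent.of_comp _ h2
  set W := Submodule.span ℚ (Set.range fun i => castQ (M i)) with hW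
  set W₀ := Submodule.span ℚ (Set.range fun i => castQ (b₀ i)) with hW₀
  have hWW₀ : W = W₀ := by
    apply le_antisymm
    · rw [hW, Submodule.span_le]
      rintro _ ⟨i, rfl⟩
      have hMi : M i ∈ A := by rw [hcl]; exact AddSubgroup.subset_closure ⟨i, rfl⟩
      exact hspan₀ _ hMi
    · rw [hW₀, Submodule.span_le]
      rintro _ ⟨i, rfl⟩
      have hmem : b₀ i ∈ AddSubgroup.closure (Set.range fun i => M i) := hcl ▸ hb₀A i
      refine AddSubgroup.closure_induction (p := fun x _ => castQ x ∈ (W : Set (Fin n → ℚ))) ?_ ?_ ?_ ?_ hmem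
      · rintro _ ⟨k, rfl⟩; exact Submodule.subset_span ⟨k, rfl⟩
      · change castQ 0 ∈ W
        have : castQ (0 : Fin n → ℤ) = 0 := by funext j; simp [castQ]
        rw [this]; exact W.zero_mem
      · intro x y _ _ hx hy
        change castQ (x + y) ∈ W
        have : castQ (x + y) = castQ x + castQ y := by funext j; simp [castQ]
        rw [this]; exact W.add_mem hx hy
      · intro x _ hx
        change castQ (-x) ∈ W
        have : castQ (-x) = -castQ x := by funext j; simp [castQ]
        rw [this]; exact W.neg_mem hx
  have hr : Module.finrank ℚ W = r := by rw [hW, finrank_span_eq_card hliQ, Fintype.card_fin]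
  have hr₀ : Module.finrank ℚ W₀ = r₀ := by rw [hW₀, finrank_span_eq_card hli₀Q, Fintype.card_fin]
  rw [htd]
  have : r = r₀ := by rw [← hr, ← hr₀, hWW₀]
  omega

/-- **General-rank multiplicity bound, minors form, for every `ℤ`-basis.** For an irreducible
closed subgroup `H = V × T_A ≤ ℂ × (ℂˣ)ⁿ`, `D₀, D₁ ≥ 1`, and ANY `ℤ`-basis `M` (`r × n`) of
`A = charGroup H`:
`(dim H)! · D₀^{dim V} · D₁^{dim T_A} · ∑_{#I = r} |det M_I| ≤ mult_{D₀,D₁}(H)`.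
[cite: Philippon1986, §3 (*) p. 362 and Lemme 3.4; Nesterenko2003, §5.1 (5.7)] -/
theorem factorial_mul_sum_absMinor_le_mult {D₀ D₁ : ℕ} (hD₀ : 1 ≤ D₀) (hD₁ : 1 ≤ D₁)
    (H : Subgroup (GaGm n)) (hirr : IsIrred (H : Set (GaGm n))) {r : ℕ} {M : Matrix (Fin r) (Fin n) ℤ}
    (hli : LinearIndependent ℤ (fun i => M i))
    (hcl : charGroup (H : Set (GaGm n)) = AddSubgroup.closure (Set.range fun i => M i)) :
    (dimG (H : Set (GaGm n))).factorial *
        (D₀ ^ (toConnAlgSubgroup H hirr).addDim * (D₁ ^ (toConnAlgSubgroup H hirr).torusDim *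
          ∑ I ∈ (Finset.univ : Finset (Fin n)).powersetCard r, absMinor M I)) ≤
        mult D₀ D₁ (H : Set (GaGm n)) := by
  classical
  have hrk := basis_card_add_torusDim_eq H hirr hli hcl
  have hmain := factorial_mul_sum_slice_le_mult hD₀ hD₁ H hirr
  set k := (toConnAlgSubgroup H hirr).torusDim with hk
  have hslice : ∀ J ∈ (Finset.univ : Finset (Fin n)).powersetCard k,
      ((H : Set (GaGm n)) ∩ {g : GaGm n | g.1 = 1 ∧ ∀ j ∈ J, g.2 j = 1}).ncard = absMinor M (Finset.univ \ J) := by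
    intro J hJ
    rw [Finset.mem_powersetCard] at hJ
    rw [ncard_inter_slice_eq_index H hirr.isClosedG J, hcl]
    exact index_closure_sup_eq_absMinor M J (by rw [hJ.2]; omega)
  have hsum : ∑ J ∈ (Finset.univ : Finset (Fin n)).powersetCard k,
      ((H : Set (GaGm n)) ∩ {g : GaGm n | g.1 = 1 ∧ ∀ j ∈ J, g.2 j = 1}).ncard =
      ∑ I ∈ (Finset.univ : Finset (Fin n)).powersetCard r, absMinor M I := by
    rw [Finset.sum_congr rfl hslice]
    refine Finset.sum_nbij' (fun J => Finset.univ \ J) (fun I => Finset.univ \ I) ?_ ?_ ?_ ?_ ?_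
    · intro J hJ
      rw [Finset.mem_powersetCard] at hJ ⊢
      refine ⟨Finset.subset_univ _, ?_⟩
      rw [Finset.card_univ_sdiff, Fintype.card_fin, hJ.2]; omega
    · intro I hI
      rw [Finset.mem_powersetCard] at hI ⊢
      refine ⟨Finset.subset_univ _, ?_⟩
      rw [Finset.card_univ_sdiff, Fintype.card_fin, hI.2]; omega
    · intro J _; simp
    · intro I _; simp
    · intro J _; rfl
  rw [hsum] at hmain
  exact hmain

end GaGm

end Literature.NumberTheory.Transcendental
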